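import Literature.Geometry.Riemannian.HCenterLocationRicciBound
import Literature.Geometry.Riemannian.LowerVolumeBoundHCenter
import Literature.Geometry.Riemannian.KernelNashEntropyW1Bound
import HarnessLib

/-!
# Lower volume bound at the basepoint under a Ricci bound (Bamler 2020a, Thm. 6.2 + Prop. 9.5)

R. Bamler, *Entropy and heat kernel bounds on a Ricci flow background*, arXiv:2008.07093 (2020a),
§6.1, remark after Thm. 6.2: "by a simple containment relationship, Theorem 6.2 also implies a
lower volume bound for a ball of radius `(√(2H_n) + D) r` if `(z, t − r²)` is `Dr`-far away from an
`H_n`-center", combined with §9.1, Prop. 9.5 (the `H_n`-centres of `(x₀, t₀)` at time `t₀ − r²`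
are within `C(α, K) r` of `x₀` as soon as `|Ric| ≤ K r⁻²` on `P(x₀, t₀; αr, −r²)`): for `m ≥ 3`,
`α > 0`, `K ≥ 0` and any `Λ` there are `c, C > 0` such that for every Ricci flow on `[a, T]` of a smooth
family of Riemannian metrics on a closed connected manifold modelled on `ℝᵐ`, all
`a < t₁ < t₀ ≤ T` (`r² = t₀ − t₁`) with `R_{t₁} ≥ R_min`, `−R_min r² ≤ Λ`, and every `x₀` with
`|Ric| ≤ K r⁻²` on `P(x₀, t₀; αr, −r²)`,

  `c r^m exp(𝒩*_{t₁}(x₀, t₀)) ≤ Vol_{t₁} B_{t₁}(x₀, C r)`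

(`exists_riemVolume_ball_ge_of_ricci_bound`). This is the form of no local collapsing used
throughout Bamler's structure theory (2020c). Everything is proved; no definitions, no named facts.

## References

* R. H. Bamler, *Entropy and heat kernel bounds on a Ricci flow background*, arXiv:2008.07093
  (2020), §6.1 Thm. 6.2 and the remark following it; §9.1 Prop. 9.5. [Bamler2020Entropy]
-/

noncomputable section

open Set Filter Function MeasureTheory Measure Module
open scoped Manifold ContDiff Topology ENNReal NNReal

namespace Literature.Geometry.Riemannian

open Lorentzian Lorentzian.PseudoRiemannianMetric

set_option maxHeartbeats 800000 in
/-- **Lower volume bound for `B_{t₀−r²}(x₀, C r)` under `|Ric| ≤ K r⁻²` on `P(x₀,t₀; αr, −r²)`**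
(Bamler 2020a, Thm. 6.2 at an `H_m`-centre `(z, t₀ − r²)` of `(x₀, t₀)` + Prop. 9.5
`d_{t₀−r²}(x₀, z) ≤ C(α,K) r` + the containment `B(z, √(2H_m) r) ⊆ B(x₀, (C + √(2H_m) + 1) r)`):
`c (t₀−t₁)^{m/2} exp(𝒩*_{t₁}(x₀,t₀)) ≤ Vol_{t₁} B_{t₁}(x₀, C √(t₀−t₁))` with `c, C` depending only on
`m, α, K, Λ` (no sign condition on `Λ` is needed). [cite: Bamler2020Entropy, §6.1 Thm. 6.2 and remark; §9.1 Prop. 9.5] -/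
theorem exists_riemVolume_ball_ge_of_ricci_bound (m : ℕ) (hm : 3 ≤ m) {α K Λ : ℝ} (hα : 0 < α)
    (hK : 0 ≤ K) :
    ∃ c C : ℝ, 0 < c ∧ 0 < C ∧ ∀ {M : Type*} [TopologicalSpace M]
      [ChartedSpace (EuclideanSpace ℝ (Fin m)) M]
      [IsManifold 𝓘(ℝ, EuclideanSpace ℝ (Fin m)) ∞ M] [T2Space M] [CompactSpace M]
      [SecondCountableTopology M] [MeasurableSpace M] [BorelSpace M] [ConnectedSpace M] [T3Space M]
      {h : ℝ → PseudoRiemannianMetric 𝓘(ℝ, EuclideanSpace ℝ (Fin m)) ∞ (EuclideanSpace ℝ (Fin m))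
        (TangentSpace 𝓘(ℝ, EuclideanSpace ℝ (Fin m)) : M → Type _)}
      {cov : ℝ → CovariantDerivative 𝓘(ℝ, EuclideanSpace ℝ (Fin m)) (EuclideanSpace ℝ (Fin m))
        (TangentSpace 𝓘(ℝ, EuclideanSpace ℝ (Fin m)) : M → Type _)}
      {a T : ℝ} (hflow : IsRicciFlow h cov (Icc a T)) (hh : IsContMDiffFamilyOn ∞ h univ)
      (hR : ∀ r, (h r).IsRiemannian),
      ∀ {t₁ t₀ : ℝ}, a < t₁ → t₁ < t₀ → t₀ ≤ T → ∀ {Rmin : ℝ},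
      (∀ y : M, Rmin ≤ (h t₁).scalarCurvatureWith (cov t₁) y) → -Rmin * (t₀ - t₁) ≤ Λ →
      ∀ x₀ : M,
      (∀ t ∈ Icc t₁ t₀, ∀ y : M,
        (h t).edist (hR t) x₀ y < ENNReal.ofReal (α * Real.sqrt (t₀ - t₁)) →
        ∀ v : TangentSpace 𝓘(ℝ, EuclideanSpace ℝ (Fin m)) y,
          |(cov t).ricci y v v| ≤ K / (t₀ - t₁) * (h t).val y v v) →
      c * (t₀ - t₁) ^ ((m : ℝ) / 2) *
          Real.exp (pointedNashEntropy h (fun r v ↦ hflow.heatKernelFn hh hR t₀ x₀ (v, r)) m t₀ t₁) ≤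
        (h t₁).riemVolume.real
          {y | (h t₁).edist (hR t₁) x₀ y < ENNReal.ofReal (C * Real.sqrt (t₀ - t₁))} := by
  classical
  set Hm : ℝ := ((m : ℝ) - 1) * Real.pi ^ 2 / 2 + 4 with hHm
  have hm0 : 0 < m := by omega
  have hHm0 : 0 < Hm := by
    have h1 : (1 : ℝ) ≤ m := by exact_mod_cast hm0
    have : 0 ≤ ((m : ℝ) - 1) * Real.pi ^ 2 / 2 := by
      apply div_nonneg _ (by norm_num); exact mul_nonneg (by linarith) (sq_nonneg _)
    rw [hHm]; linarith
  obtain ⟨C₉, hC₉, H95⟩ := exists_edist_hCenter_le_of_ricci_bound m hm hα hK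
  -- the constants
  set c : ℝ := 1 / 2 * (4 * Real.pi) ^ ((m : ℝ) / 2) * Real.exp ((m : ℝ) / 2) *
    Real.exp (-2 * Real.sqrt ((m : ℝ) + 2 * Λ)) with hc
  have hc0 : 0 < c := by positivity
  set C : ℝ := C₉ + Real.sqrt (2 * Hm) + 1 with hC
  have hC0 : 0 < C := by positivity
  refine ⟨c, C, hc0, hC0, ?_⟩
  intro M _ _ _ _ _ _ _ _ _ _ h cov a T hflow hh hR t₁ t₀ hat₁ h10 ht₀T Rmin hRmin hRΛ x₀ hRic
  set r : ℝ := Real.sqrt (t₀ - t₁) with hr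
  have hτ : 0 < t₀ - t₁ := sub_pos.2 h10
  have hr0 : 0 < r := Real.sqrt_pos.2 hτ
  have hr2 : r ^ 2 = t₀ - t₁ := Real.sq_sqrt hτ.le
  -- an `H_m`-centre `z` of `(x₀, t₀)` at time `t₁`, and its distance from `x₀`
  obtain ⟨z, hz⟩ := hflow.exists_lintegral_edist_sq_heatKernelMeasure_le hh hR hm0
    ⟨hat₁.le, h10.le.trans ht₀T⟩ ⟨(hat₁.trans h10).le, ht₀T⟩ h10.le x₀
  have hdz : ((h t₁).edist (hR t₁) x₀ z).toReal ≤ C₉ * r :=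
    H95 hflow hh hR hat₁ h10 ht₀T x₀ hRic z hz
  -- Thm 6.2 at the centre
  have h62 := riemVolume_ball_ge_of_hCenter hflow hh hR hm hat₁ h10 ht₀T x₀ z hz hRmin
  -- the containment `B(z, √(2 Hm (t₀−t₁))) ⊆ B(x₀, C r)`
  have hsub : {y | (h t₁).edist (hR t₁) z y < ENNReal.ofReal (Real.sqrt (2 * (Hm * (t₀ - t₁))))} ⊆
      {y | (h t₁).edist (hR t₁) x₀ y < ENNReal.ofReal (C * r)} := by
    intro y hy
    simp only [mem_setOf_eq] at hy ⊢
    have hfin1 : (h t₁).edist (hR t₁) x₀ z ≠ ⊤ := PseudoRiemannianMetric.edist_ne_top (hR t₁) _ _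
    have hfin2 : (h t₁).edist (hR t₁) z y ≠ ⊤ := PseudoRiemannianMetric.edist_ne_top (hR t₁) _ _
    have hzy : ((h t₁).edist (hR t₁) z y).toReal < Real.sqrt (2 * Hm) * r := by
      have h1 := ENNReal.toReal_lt_of_lt_ofReal hy
      rwa [show Real.sqrt (2 * (Hm * (t₀ - t₁))) = Real.sqrt (2 * Hm) * r by
        rw [hr, ← Real.sqrt_mul (by positivity)]; ring_nf] at h1
    have htri : (h t₁).edist (hR t₁) x₀ y ≤ (h t₁).edist (hR t₁) x₀ z + (h t₁).edist (hR t₁) z y :=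
      PseudoRiemannianMetric.edist_triangle (hR t₁) x₀ z y
    have hreal : ((h t₁).edist (hR t₁) x₀ y).toReal < C * r := by
      have h1 : ((h t₁).edist (hR t₁) x₀ y).toReal ≤
          ((h t₁).edist (hR t₁) x₀ z).toReal + ((h t₁).edist (hR t₁) z y).toReal := by
        rw [← ENNReal.toReal_add hfin1 hfin2]
        exact ENNReal.toReal_mono (ENNReal.add_ne_top.2 ⟨hfin1, hfin2⟩) htri
      have h2 : C * r = C₉ * r + Real.sqrt (2 * Hm) * r + r := by rw [hC]; ring
      rw [h2]; linarith
    have hfin3 : (h t₁).edist (hR t₁) x₀ y ≠ ⊤ := PseudoRiemannianMetric.edist_ne_top (hR t₁) _ _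
    rw [← ENNReal.ofReal_toReal hfin3]
    exact (ENNReal.ofReal_lt_ofReal_iff (by positivity)).2 hreal
  -- compare the constants: `c (t₀−t₁)^{m/2} e^{N} ≤` the constant of Thm 6.2
  set N : ℝ := pointedNashEntropy h (fun r v ↦ hflow.heatKernelFn hh hR t₀ x₀ (v, r)) m t₀ t₁
    with hN
  have hconst : c * (t₀ - t₁) ^ ((m : ℝ) / 2) * Real.exp N ≤
      1 / 2 * (4 * Real.pi * (t₀ - t₁)) ^ ((m : ℝ) / 2) * Real.exp ((m : ℝ) / 2) *
        Real.exp (-2 * Real.sqrt ((m : ℝ) - 2 * Rmin * (t₀ - t₁))) * Real.exp N := by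
    have hsqrt : Real.sqrt ((m : ℝ) - 2 * Rmin * (t₀ - t₁)) ≤ Real.sqrt ((m : ℝ) + 2 * Λ) :=
      Real.sqrt_le_sqrt (by nlinarith)
    have hexp : Real.exp (-2 * Real.sqrt ((m : ℝ) + 2 * Λ)) ≤
        Real.exp (-2 * Real.sqrt ((m : ℝ) - 2 * Rmin * (t₀ - t₁))) :=
      Real.exp_le_exp.2 (by linarith)
    have hsplit : (4 * Real.pi * (t₀ - t₁)) ^ ((m : ℝ) / 2) =
        (4 * Real.pi) ^ ((m : ℝ) / 2) * (t₀ - t₁) ^ ((m : ℝ) / 2) :=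
      Real.mul_rpow (by positivity) hτ.le
    rw [hsplit, hc]
    have hP : 0 ≤ 1 / 2 * ((4 * Real.pi) ^ ((m : ℝ) / 2) * (t₀ - t₁) ^ ((m : ℝ) / 2)) *
        Real.exp ((m : ℝ) / 2) * Real.exp N := by positivity
    calc 1 / 2 * (4 * Real.pi) ^ ((m : ℝ) / 2) * Real.exp ((m : ℝ) / 2) *
          Real.exp (-2 * Real.sqrt ((m : ℝ) + 2 * Λ)) * (t₀ - t₁) ^ ((m : ℝ) / 2) * Real.exp N
        = (1 / 2 * ((4 * Real.pi) ^ ((m : ℝ) / 2) * (t₀ - t₁) ^ ((m : ℝ) / 2)) *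
            Real.exp ((m : ℝ) / 2) * Real.exp N) * Real.exp (-2 * Real.sqrt ((m : ℝ) + 2 * Λ)) := by
          ring
      _ ≤ (1 / 2 * ((4 * Real.pi) ^ ((m : ℝ) / 2) * (t₀ - t₁) ^ ((m : ℝ) / 2)) *
            Real.exp ((m : ℝ) / 2) * Real.exp N) *
            Real.exp (-2 * Real.sqrt ((m : ℝ) - 2 * Rmin * (t₀ - t₁))) :=
          mul_le_mul_of_nonneg_left hexp hP
      _ = _ := by ring
  -- assemble in `ℝ≥0∞`, then back to `ℝ`
  haveI : IsFiniteMeasure (h t₁).riemVolume := ⟨(h t₁).riemVolume_univ_lt_top⟩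
  have hvol : ENNReal.ofReal (c * (t₀ - t₁) ^ ((m : ℝ) / 2) * Real.exp N) ≤
      (h t₁).riemVolume {y | (h t₁).edist (hR t₁) x₀ y < ENNReal.ofReal (C * r)} :=
    calc ENNReal.ofReal (c * (t₀ - t₁) ^ ((m : ℝ) / 2) * Real.exp N)
        ≤ ENNReal.ofReal (1 / 2 * (4 * Real.pi * (t₀ - t₁)) ^ ((m : ℝ) / 2) * Real.exp ((m : ℝ) / 2) *
            Real.exp (-2 * Real.sqrt ((m : ℝ) - 2 * Rmin * (t₀ - t₁))) * Real.exp N) :=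
          ENNReal.ofReal_le_ofReal hconst
      _ ≤ (h t₁).riemVolume {y | (h t₁).edist (hR t₁) z y <
            ENNReal.ofReal (Real.sqrt (2 * ((((m : ℝ) - 1) * Real.pi ^ 2 / 2 + 4) * (t₀ - t₁))))} := h62
      _ ≤ (h t₁).riemVolume {y | (h t₁).edist (hR t₁) x₀ y < ENNReal.ofReal (C * r)} :=
          measure_mono (by simpa [hHm] using hsub)
  rw [measureReal_def, ← ENNReal.ofReal_le_iff_le_toReal (measure_ne_top _ _)]
  rwa [hr] at hvol

end Literature.Geometry.Riemannian

end
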